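import Literature.Topology.PlanarFoliations.CompactLeaf
import Mathlib.Topology.Algebra.Order.Floor
import HarnessLib

/-!
# Parametrising a compact leaf by an injective loop

Topic: Topology / PlanarFoliations, sequel to `CompactLeaf.lean`. From the two-ends structure
of a pair of covering arc charts of a compact connected `1`-manifold (Milnor), a **simple closed
curve onto the whole space**: run along the first arc between the two overlap ends, then back
along the second.

* `exists_loop_of_twoEnds` (**proved**, generic): for `TwoEnds e f a₁ a₂ b₁ b₂` with
  `e.source ∪ f.source = univ` there is `γ : ℝ → M`, continuous, `1`-periodic, injective on
  `[0, 1)`, onto `M`;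
* `exists_leafLoop` (**proved**): every compact leaf of a bi-oriented planar foliation admits
  such a loop in its leaf topology (`Literature.Topology.PlanarFoliations.LoopLeaf` uses loops
  of exactly this form).

All statements are [folklore].
-/

noncomputable section

open Set Filter Function Topology unitInterval
open Literature.Topology.FourManifolds Literature.Topology.FourManifolds.Foliation
  Literature.Topology.FourManifolds.OneManifold

namespace Literature.Topology.PlanarFoliations

section Generic

variable {M : Type*} [TopologicalSpace M] {e f : OpenPartialHomeomorph M ℝ} {a₁ a₂ b₁ b₂ : ℝ}

/-- In a two-ends structure the two ends of `f` are in the right order: `b₁ ≤ b₂`. [folklore] -/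
theorem TwoEnds.b_le (T : TwoEnds e f a₁ a₂ b₁ b₂) (he : e.target = univ) : b₁ ≤ b₂ := by
  by_contra hlt
  push Not at hlt
  obtain ⟨hle, h1, h2, -, -, -⟩ := T
  set B := (b₁ + b₂) / 2 with hB
  have hB1 : B < b₁ := by rw [hB]; linarith
  have hB2 : b₂ < B := by rw [hB]; linarith
  have m1 : f.symm B ∈ e.symm '' Ioi a₁ := by rw [h1]; exact ⟨B, hB1, rfl⟩
  have m2 : f.symm B ∈ e.symm '' Iio a₂ := by rw [h2]; exact ⟨B, hB2, rfl⟩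
  obtain ⟨A, hA, hAe⟩ := m1
  obtain ⟨A', hA', hA'e⟩ := m2
  have : A = A' := e.symm.injOn (by rw [OpenPartialHomeomorph.symm_source, he]; exact mem_univ _)
    (by rw [OpenPartialHomeomorph.symm_source, he]; exact mem_univ _) (hAe.trans hA'e.symm)
  rw [mem_Ioi] at hA; rw [mem_Iio] at hA'
  linarith

/-- **A loop onto a two-ends space**: continuous, `1`-periodic, injective on a period, onto.
[folklore] -/
theorem exists_loop_of_twoEnds (T : TwoEnds e f a₁ a₂ b₁ b₂) (he : e.target = univ) (hf : f.target = univ)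
    (hcov : e.source ∪ f.source = univ) :
    ∃ γ : ℝ → M, Continuous γ ∧ Periodic γ 1 ∧ InjOn γ (Ico 0 1) ∧ range γ = univ := by
  have hb := T.b_le he
  obtain ⟨hle, h1, h2, hov, hm1, hm2⟩ := T
  have hes : ∀ a : ℝ, a ∈ e.target := fun a ↦ by rw [he]; exact mem_univ _
  have hfs : ∀ b : ℝ, b ∈ f.target := fun b ↦ by rw [hf]; exact mem_univ _
  have hesymm : Continuous e.symm := by
    have := e.continuousOn_symm; rw [he, continuousOn_univ] at this; exact this
  have hfsymm : Continuous f.symm := by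
    have := f.continuousOn_symm; rw [hf, continuousOn_univ] at this; exact this
  -- the two gluing points
  set A : ℝ := a₁ + 1 with hA
  set A' : ℝ := a₂ - 1 with hA'
  have hAA' : A' < A := by rw [hA, hA']; linarith
  obtain ⟨B₁, hB₁, hPB₁⟩ : ∃ B₁ ∈ Iio b₁, f.symm B₁ = e.symm A := by
    have : e.symm A ∈ e.symm '' Ioi a₁ := ⟨A, by rw [hA, mem_Ioi]; linarith, rfl⟩
    rw [h1] at this
    obtain ⟨B, hB, hBe⟩ := this
    exact ⟨B, hB, hBe⟩
  obtain ⟨B₂, hB₂, hPB₂⟩ : ∃ B₂ ∈ Ioi b₂, f.symm B₂ = e.symm A' := by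
    have : e.symm A' ∈ e.symm '' Iio a₂ := ⟨A', by rw [hA', mem_Iio]; linarith, rfl⟩
    rw [h2] at this
    obtain ⟨B, hB, hBe⟩ := this
    exact ⟨B, hB, hBe⟩
  rw [mem_Iio] at hB₁; rw [mem_Ioi] at hB₂
  have hBB : B₁ < B₂ := by linarith
  -- values of `f` at the gluing points
  have hfB₁ : f (e.symm A) = B₁ := by rw [← hPB₁, f.right_inv (hfs _)]
  have hfB₂ : f (e.symm A') = B₂ := by rw [← hPB₂, f.right_inv (hfs _)]
  -- the loop on one period and its periodic extension
  set γ₀ : ℝ → M := fun θ ↦ if θ ≤ 1 / 2 then e.symm (A' + 2 * θ * (A - A')) else f.symm (B₁ + (2 * θ - 1) * (B₂ - B₁))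
    with hγ₀
  have hγ₀c : Continuous γ₀ := by
    refine Continuous.if_le ?_ ?_ continuous_id continuous_const ?_
    · exact hesymm.comp (by fun_prop)
    · exact hfsymm.comp (by fun_prop)
    · rintro θ rfl
      norm_num
      exact hPB₁.symm
  have hγ₀01 : γ₀ 0 = γ₀ 1 := by
    simp only [hγ₀]
    rw [if_pos (by norm_num), if_neg (by norm_num)]
    norm_num
    exact hPB₂.symm
  set γ : ℝ → M := fun θ ↦ γ₀ (Int.fract θ) with hγ
  have hγc : Continuous γ := ContinuousOn.comp_fract'' hγ₀c.continuousOn hγ₀01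
  have hγp : Periodic γ 1 := fun θ ↦ by simp only [hγ]; rw [Int.fract_add_one]
  have hγeq : ∀ θ ∈ Ico (0 : ℝ) 1, γ θ = γ₀ θ := fun θ hθ ↦ by
    simp only [hγ]; rw [Int.fract_eq_self.2 hθ]
  -- formulas on the two halves
  have hγ₀l : ∀ θ, θ ≤ 1 / 2 → γ₀ θ = e.symm (A' + 2 * θ * (A - A')) := fun θ hθ ↦ if_pos hθ
  have hγ₀r : ∀ θ, 1 / 2 < θ → γ₀ θ = f.symm (B₁ + (2 * θ - 1) * (B₂ - B₁)) := fun θ hθ ↦ if_neg (not_le.2 hθ)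
  refine ⟨γ, hγc, hγp, ?_, ?_⟩
  · -- injectivity on `[0, 1)`
    have einj : ∀ a a' : ℝ, e.symm a = e.symm a' → a = a' := fun a a' h ↦
      e.symm.injOn (by rw [OpenPartialHomeomorph.symm_source]; exact hes _)
        (by rw [OpenPartialHomeomorph.symm_source]; exact hes _) h
    have finj : ∀ b b' : ℝ, f.symm b = f.symm b' → b = b' := fun b b' h ↦
      f.symm.injOn (by rw [OpenPartialHomeomorph.symm_source]; exact hfs _)
        (by rw [OpenPartialHomeomorph.symm_source]; exact hfs _) h
    -- a point `e.symm a`, `a ∈ [A', A]`, equal to `f.symm b` forces `b ∉ (B₁, B₂)`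
    have cross : ∀ a ∈ Icc A' A, ∀ b ∈ Ioo B₁ B₂, e.symm a ≠ f.symm b := by
      intro a ha b hbI heq
      have hov' : e.symm a ∈ e.source ∩ f.source :=
        ⟨e.map_target (hes _), by rw [heq]; exact f.map_target (hfs _)⟩
      rw [hov] at hov'
      have hfa : f (e.symm a) = b := by rw [heq, f.right_inv (hfs _)]
      rcases hov' with ⟨a', ha', hae⟩ | ⟨a', ha', hae⟩
      · have := einj _ _ hae; subst this
        -- `a ∈ (a₁, A]`: `f (e.symm a) ≤ f (e.symm A) = B₁`
        have hmono := hm1.monotoneOn ha' (show A ∈ Ioi a₁ by rw [mem_Ioi, hA]; linarith) ha.2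
        simp only [Function.comp_apply] at hmono
        rw [hfa, hfB₁] at hmono
        exact absurd hbI.1 (not_lt.2 hmono)
      · have := einj _ _ hae; subst this
        have hmono := hm2.monotoneOn (show A' ∈ Iio a₂ by rw [mem_Iio, hA']; linarith) ha' ha.1
        simp only [Function.comp_apply] at hmono
        rw [hfa, hfB₂] at hmono
        exact absurd hbI.2 (not_lt.2 hmono)
    intro θ hθ θ' hθ' hγγ
    rw [hγeq θ hθ, hγeq θ' hθ'] at hγγ
    have hAApos : 0 < A - A' := by linarith
    have hBBpos : 0 < B₂ - B₁ := by linarith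
    rcases le_or_gt θ (1 / 2) with h₁ | h₁ <;> rcases le_or_gt θ' (1 / 2) with h₂ | h₂
    · rw [hγ₀l θ h₁, hγ₀l θ' h₂] at hγγ
      have := einj _ _ hγγ
      nlinarith
    · rw [hγ₀l θ h₁, hγ₀r θ' h₂] at hγγ
      exfalso
      refine cross _ ⟨by nlinarith [hθ.1], by nlinarith⟩ _ ⟨by nlinarith, by nlinarith [hθ'.2]⟩ hγγ
    · rw [hγ₀r θ h₁, hγ₀l θ' h₂] at hγγ
      exfalso
      refine cross _ ⟨by nlinarith [hθ'.1], by nlinarith⟩ _ ⟨by nlinarith, by nlinarith [hθ.2]⟩ hγγ.symm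
    · rw [hγ₀r θ h₁, hγ₀r θ' h₂] at hγγ
      have := finj _ _ hγγ
      have : (2 * θ - 1) * (B₂ - B₁) = (2 * θ' - 1) * (B₂ - B₁) := by linarith
      have := mul_right_cancel₀ hBBpos.ne' this
      linarith
  · -- onto
    apply eq_univ_of_forall
    intro p
    -- parameters realising a point of `e.symm [A', A]` or of `f.symm [B₁, B₂]`
    have real_e : ∀ a ∈ Icc A' A, e.symm a ∈ range γ := by
      intro a ha
      set θ := (a - A') / (2 * (A - A')) with hθ
      have hθ0 : 0 ≤ θ := div_nonneg (by linarith [ha.1]) (by linarith)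
      have hθ1 : θ ≤ 1 / 2 := by rw [hθ, div_le_iff₀ (by linarith)]; linarith [ha.2]
      refine ⟨θ, ?_⟩
      rw [hγeq θ ⟨hθ0, by linarith⟩, hγ₀l θ hθ1]
      congr 1
      have hne : (2 * (A - A')) ≠ 0 := by positivity
      rw [hθ, mul_comm 2 θ, mul_assoc, show (a - A') / (2 * (A - A')) * (2 * (A - A')) = a - A' from
        div_mul_cancel₀ _ hne]
      ring
    have real_f : ∀ b ∈ Icc B₁ B₂, f.symm b ∈ range γ := by
      intro b hbI
      rcases eq_or_lt_of_le hbI.1 with heq | hlt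
      · rw [← heq, hPB₁]; exact real_e A ⟨hAA'.le, le_rfl⟩
      rcases eq_or_lt_of_le hbI.2 with heq | hlt'
      · rw [heq, hPB₂]; exact real_e A' ⟨le_rfl, hAA'.le⟩
      set θ := 1 / 2 + (b - B₁) / (2 * (B₂ - B₁)) with hθ
      have hθ1 : 1 / 2 < θ := by
        rw [hθ]; have : 0 < (b - B₁) / (2 * (B₂ - B₁)) := div_pos (by linarith) (by linarith); linarith
      have hθ2 : θ < 1 := by
        rw [hθ]
        have : (b - B₁) / (2 * (B₂ - B₁)) < 1 / 2 := by rw [div_lt_iff₀ (by linarith)]; linarith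
        linarith
      refine ⟨θ, ?_⟩
      rw [hγeq θ ⟨by linarith, hθ2⟩, hγ₀r θ hθ1]
      congr 1
      have hne : (2 * (B₂ - B₁)) ≠ 0 := by positivity
      have e1 : 2 * (1 / 2 + (b - B₁) / (2 * (B₂ - B₁))) - 1 = (b - B₁) / (2 * (B₂ - B₁)) * 2 := by ring
      have e2 : (b - B₁) / (2 * (B₂ - B₁)) * 2 * (B₂ - B₁) = b - B₁ := by
        rw [mul_assoc, div_mul_cancel₀ _ hne]
      rw [hθ, e1, e2]
      ring
    by_cases hpe : p ∈ e.source
    · set a := e p with ha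
      have hp : p = e.symm a := (e.left_inv hpe).symm
      rcases le_or_gt a A with h₁ | h₁
      · rcases le_or_gt A' a with h₂ | h₂
        · rw [hp]; exact real_e a ⟨h₂, h₁⟩
        · -- `a < A'`: in the left end of `e`, i.e. the right end of `f`
          have hm : p ∈ e.symm '' Iio a₂ := ⟨a, by rw [mem_Iio, hA'] at *; linarith, hp.symm⟩
          rw [h2] at hm
          obtain ⟨b, hb2, hbp⟩ := hm
          have hfb : f p = b := by rw [← hbp, f.right_inv (hfs _)]
          have hmono := hm2 (show a ∈ Iio a₂ by rw [mem_Iio, hA'] at *; linarith)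
            (show A' ∈ Iio a₂ by rw [mem_Iio, hA']; linarith) h₂
          simp only [Function.comp_apply] at hmono
          rw [← hp, hfb, hfB₂] at hmono
          rw [← hbp]
          exact real_f b ⟨by rw [mem_Ioi] at hb2; linarith, hmono.le⟩
      · -- `A < a`: in the right end of `e`, i.e. the left end of `f`
        have hm : p ∈ e.symm '' Ioi a₁ := ⟨a, by rw [mem_Ioi, hA] at *; linarith, hp.symm⟩
        rw [h1] at hm
        obtain ⟨b, hb1, hbp⟩ := hm
        have hfb : f p = b := by rw [← hbp, f.right_inv (hfs _)]
        have hmono := hm1 (show A ∈ Ioi a₁ by rw [mem_Ioi, hA]; linarith)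
          (show a ∈ Ioi a₁ by rw [mem_Ioi, hA] at *; linarith) h₁
        simp only [Function.comp_apply] at hmono
        rw [← hp, hfb, hfB₁] at hmono
        rw [← hbp]
        exact real_f b ⟨hmono.le, by rw [mem_Iio] at hb1; linarith⟩
    · -- `p ∉ e.source`: `p = f.symm b` with `b ∈ [b₁, b₂]`
      have hpf : p ∈ f.source := by
        have : p ∈ e.source ∪ f.source := by rw [hcov]; exact mem_univ _
        exact this.resolve_left hpe
      set b := f p with hb'
      have hp : p = f.symm b := (f.left_inv hpf).symm
      have hb1 : b₁ ≤ b := by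
        by_contra hlt; push Not at hlt
        have : p ∈ f.symm '' Iio b₁ := ⟨b, hlt, hp.symm⟩
        rw [← h1] at this
        obtain ⟨a, -, hap⟩ := this
        exact hpe (hap ▸ e.map_target (hes _))
      have hb2 : b ≤ b₂ := by
        by_contra hlt; push Not at hlt
        have : p ∈ f.symm '' Ioi b₂ := ⟨b, hlt, hp.symm⟩
        rw [← h2] at this
        obtain ⟨a, -, hap⟩ := this
        exact hpe (hap ▸ e.map_target (hes _))
      rw [hp]
      exact real_f b ⟨by linarith, by linarith⟩

end Generic

/-! ## Compact leaves -/

section Leaf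

variable {X : Type*} [TopologicalSpace X] [T2Space X] [SecondCountableTopology X] {F : Foliation ℝ X} {x : X}

omit [SecondCountableTopology X] in
/-- **A compact leaf of a bi-oriented planar foliation is parametrised by an injective loop**
(in its leaf topology): continuous, `1`-periodic, injective on `[0, 1)`, onto. [folklore] -/
theorem exists_leafLoop [CompactSpace (F.Leaf x)] (hbi : IsBiOriented F) :
    ∃ γ : ℝ → F.Leaf x, Continuous γ ∧ Periodic γ 1 ∧ InjOn γ (Ico 0 1) ∧ range γ = univ := by
  obtain ⟨g₁, g₂, hg₁, hg₂, hcov, ha₁, ha₂⟩ := exists_two_agreeing_arcCharts (x := x) hbi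
  obtain ⟨e, f, a₁, a₂, b₁, b₂, he, hf, hes, hfs, T⟩ :=
    exists_twoEnds_of_pair hg₁ hg₂ hcov (fun q hq ↦ eventually_lt_iff_of_agrees ha₁ ha₂ hq)
  exact exists_loop_of_twoEnds T he hf (by rw [hes, hfs, hcov])

/-- **A compact leaf (as a subset) is parametrised by an injective leaf loop.** [folklore] -/
theorem exists_leafLoop_of_isCompact (hbi : IsBiOriented F) (hC : IsCompact (F.leaf x)) :
    ∃ γ : ℝ → F.Leaf x, Continuous γ ∧ Periodic γ 1 ∧ InjOn γ (Ico 0 1) ∧ range γ = univ := by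
  haveI := compactSpace_leaf_of_isCompact hC
  exact exists_leafLoop hbi

end Leaf

end Literature.Topology.PlanarFoliations
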